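import Mathlib.Tactic
import HarnessLib

/-!
# Kozma–Nitzan's Question 8 — UNI-C(U;y) for every block: the Ξ-lemma and the unified general-prefix members (gen 42)

Support file (`--supports stmt-CriticalPhenomena-4575`, closed crux; independent mathematics on Kozma–Nitzan's Question 8,
arXiv:2401.12397 §5.5 p. 36), prover `prim-ineq-gen-6` (gen 42).  No definitions, no named facts, no sorries; standard axioms.
Memo `run/shared/lean/prim/prim-ineq-gen-6/PROOF-UNIC-PRE-G42.md` (THEOREM UNI-C-GEN: the C-side corner condition UNI-C(U;y) at every
C-hypothesis node of every block with `c > 0`, prefix A-defects allowed; one unified pair of members and one box certificate).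

* `kGen_G` — the flat factor seen from the last positive depth: `γ_iΛ ≤ 1/(C' + (1−C')ζ)` with `C' = C_[k₁,t]`, `γ_t = γ_iC'`, `γ_i ≤ 1`;
* `kGen_xi_core`, `kGen_xi_mono`, `kGen_xi` — THE Ξ-LEMMA: with `u(1−ε) ≤ C'` (THEOREM U‴) and `G ≤ 1/(C'+(1−C')ζ)`:
  `G·u ≤ Ξ(u)/(1−ε)`, `Ξ(u) = u/(u + (1−u)ζ)` — the product (need flat factor) × (A-view) is at most `Ξ(u_{k₁}, fã) ≤ Ξ(ū, fã)` instead of `1`;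
* `kGen_xi_small` — the case `fã ≤ 1` (`Λ ≤ 1`): the product is `≤ u`;
* `kGen_fat_le` — `a_l·fã_l ≤ 1 − a_l` (`fã_l = 1/a_l − 1/a_0`, `a_0 ≤ 1`): the per-depth kill core `kLC_core_depth` applies with `fã` (prefix A-death is kill-visible);
* `kGen_member1`, `kGen_member2` — assembly of the unified joint / kill members `M1'' = Ξ·POST₂x/M_v`, `M2'' = Ξ·q₃x/((1−ǔ)Φ·BRG)`;
* `kGen_SLprime` — the telescoping step `(1−s_{j+1})S ≤ S_j − S_{j+1}` behind `S·L' ≤ 1 − S`;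
* `kGen_PA_ratio` — the prefix A-loss ratio `r = d/(uS) ≤ (4/3)a²x` from LEMMA (PA) and `K₃ − H ≥ ¾(Φ+m)`;
* `kGen_eps` — `ε'' = Q₊/(u·m_t) ≤ a₀⁴x²S(1−S)(1+r)/3`;
* `kGen_gmono`, `kGen_DM_uc`, `kGen_DM_alpha` — the monotonicity facts used by the box certificate b05 (`g(x,θ)/θ` increasing in `θ`;
  `D'/M` decreasing in `ǔ`, increasing in `α`).
[cite: KozmaNitzan2024, Question 8 (§5.5 p. 36)]
-/

namespace Summit.CriticalPhenomena.PercolationContinuityZ3.Theorems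

namespace PocketCert

/-- **Flat factor from the last positive depth.**  If `Λ ≤ 1/(γC + (1 − γC)ζ)` (the flat factor with `γ_t = γ_i·C'`), `0 ≤ γ ≤ 1`,
`0 ≤ C ≤ 1`, `0 < ζ`, then `γ·Λ ≤ 1/(C + (1−C)ζ)`.
[cite: KozmaNitzan2024, Question 8 (§5.5 p. 36)] -/
theorem kGen_G (Λ γ C ζ : ℝ) (hγ0 : 0 ≤ γ) (hγ1 : γ ≤ 1) (hC0 : 0 ≤ C) (hC1 : C ≤ 1) (hζ : 0 < ζ)
    (hΛ : Λ ≤ 1 / (γ * C + (1 - γ * C) * ζ)) :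
    γ * Λ ≤ 1 / (C + (1 - C) * ζ) := by
  have hγC1 : γ * C ≤ 1 := by nlinarith
  have hD1 : 0 < γ * C + (1 - γ * C) * ζ := by
    rcases eq_or_lt_of_le (mul_nonneg hγ0 hC0) with h | h
    · rw [← h]; simpa using hζ
    · nlinarith [mul_nonneg (sub_nonneg.mpr hγC1) hζ.le]
  have hD2 : 0 < C + (1 - C) * ζ := by
    rcases eq_or_lt_of_le hC0 with h | h
    · rw [← h]; simpa using hζ
    · nlinarith [mul_nonneg (sub_nonneg.mpr hC1) hζ.le]
  have h1 : γ * Λ ≤ γ * (1 / (γ * C + (1 - γ * C) * ζ)) := mul_le_mul_of_nonneg_left hΛ hγ0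
  have h2 : γ * (1 / (γ * C + (1 - γ * C) * ζ)) ≤ 1 / (C + (1 - C) * ζ) := by
    rw [mul_one_div, div_le_div_iff₀ hD1 hD2, one_mul]
    -- γ (C + (1−C)ζ) ≤ γC + (1−γC)ζ  ⟺  γ(1−C)ζ ≤ (1−γC)ζ  ⟺ γ − γC ≤ 1 − γC
    nlinarith [mul_nonneg (sub_nonneg.mpr hγ1) hζ.le]
  exact le_trans h1 h2

/-- **Ξ-lemma, core step.**  For `0 < ζ ≤ 1` and `0 ≤ w ≤ C ≤ 1`:  `w/(C + (1−C)ζ) ≤ w/(w + (1−w)ζ)` (the denominator `y + (1−y)ζ` is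
non-decreasing in `y` when `ζ ≤ 1`).
[cite: KozmaNitzan2024, Question 8 (§5.5 p. 36)] -/
theorem kGen_xi_core (w C ζ : ℝ) (hζ0 : 0 < ζ) (hζ1 : ζ ≤ 1) (hw0 : 0 ≤ w) (hwC : w ≤ C) (hC1 : C ≤ 1) :
    w / (C + (1 - C) * ζ) ≤ w / (w + (1 - w) * ζ) := by
  have hw1 : w ≤ 1 := le_trans hwC hC1
  have hDw : 0 < w + (1 - w) * ζ := by
    rcases eq_or_lt_of_le hw0 with h | h
    · rw [← h]; simpa using hζ0
    · nlinarith [mul_nonneg (sub_nonneg.mpr hw1) hζ0.le]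
  have hDC : w + (1 - w) * ζ ≤ C + (1 - C) * ζ := by nlinarith
  exact div_le_div_of_nonneg_left hw0 hDw hDC

/-- **Ξ is non-decreasing.**  For `0 < ζ` and `0 ≤ w ≤ u ≤ 1`:  `w/(w + (1−w)ζ) ≤ u/(u + (1−u)ζ)`.
[cite: KozmaNitzan2024, Question 8 (§5.5 p. 36)] -/
theorem kGen_xi_mono (w u ζ : ℝ) (hζ0 : 0 < ζ) (hw0 : 0 ≤ w) (hwu : w ≤ u) (hu1 : u ≤ 1) :
    w / (w + (1 - w) * ζ) ≤ u / (u + (1 - u) * ζ) := by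
  have hu0 : 0 ≤ u := le_trans hw0 hwu
  have hw1 : w ≤ 1 := le_trans hwu hu1
  have hDw : 0 < w + (1 - w) * ζ := by
    rcases eq_or_lt_of_le hw0 with h | h
    · rw [← h]; simpa using hζ0
    · nlinarith [mul_nonneg (sub_nonneg.mpr hw1) hζ0.le]
  have hDu : 0 < u + (1 - u) * ζ := by
    rcases eq_or_lt_of_le hu0 with h | h
    · rw [← h]; simpa using hζ0
    · nlinarith [mul_nonneg (sub_nonneg.mpr hu1) hζ0.le]
  rw [div_le_div_iff₀ hDw hDu]
  -- w(u + (1−u)ζ) ≤ u(w + (1−w)ζ) ⟺ wζ − wuζ ≤ uζ − uwζ ⟺ wζ ≤ uζ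
  nlinarith [mul_le_mul_of_nonneg_right hwu hζ0.le]

/-- **THE Ξ-LEMMA (fã ≥ 1).**  At a C-hypothesis node THEOREM U‴ gives `u_{k₁}(1−ε) ≤ C' := C_[k₁,t]`, and the flat factor gives
`G := γ_iΛ̃ ≤ 1/(C' + (1−C')ζ)` with `ζ = 1/fã ∈ (0,1]`.  Then the product need-factor × A-view satisfies
`G·u ≤ Ξ(u)/(1−ε)`, `Ξ(u) := u/(u + (1−u)ζ) = u·fã/(u·fã + 1 − u)` (and `Ξ(u) ≤ Ξ(ū)` for `u ≤ ū` by `kGen_xi_mono`).  Gen 40 used `G·u ≤ 1/(1−ε)`.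
[cite: KozmaNitzan2024, Question 8 (§5.5 p. 36)] -/
theorem kGen_xi (G u C ζ ε : ℝ) (hζ0 : 0 < ζ) (hζ1 : ζ ≤ 1) (hu0 : 0 ≤ u) (hu1 : u ≤ 1) (hε0 : 0 ≤ ε) (hε1 : ε < 1)
    (hC1 : C ≤ 1) (huC : u * (1 - ε) ≤ C) (hG : G ≤ 1 / (C + (1 - C) * ζ)) :
    G * u ≤ u / (u + (1 - u) * ζ) / (1 - ε) := by
  set w := u * (1 - ε) with hw
  have hw0 : 0 ≤ w := mul_nonneg hu0 (by linarith)
  have hwu : w ≤ u := by rw [hw]; nlinarith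
  have hC0 : 0 ≤ C := le_trans hw0 huC
  have hDC : 0 < C + (1 - C) * ζ := by
    rcases eq_or_lt_of_le hC0 with h | h
    · rw [← h]; simpa using hζ0
    · nlinarith [mul_nonneg (sub_nonneg.mpr hC1) hζ0.le]
  have h1 : G * w ≤ w / (C + (1 - C) * ζ) := by
    calc G * w ≤ 1 / (C + (1 - C) * ζ) * w := mul_le_mul_of_nonneg_right hG hw0
      _ = w / (C + (1 - C) * ζ) := by ring
  have h2 : w / (C + (1 - C) * ζ) ≤ w / (w + (1 - w) * ζ) := kGen_xi_core w C ζ hζ0 hζ1 hw0 huC hC1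
  have h3 : w / (w + (1 - w) * ζ) ≤ u / (u + (1 - u) * ζ) := kGen_xi_mono w u ζ hζ0 hw0 hwu hu1
  have h4 : G * w ≤ u / (u + (1 - u) * ζ) := le_trans h1 (le_trans h2 h3)
  have h1e : 0 < 1 - ε := by linarith
  rw [le_div_iff₀ h1e]
  calc G * u * (1 - ε) = G * w := by rw [hw]; ring
    _ ≤ u / (u + (1 - u) * ζ) := h4

/-- **The case fã ≤ 1.**  If `Λ̃ ≤ 1` (fã ≤ 1, `kCS_leafA_lambda`), `γ_i ≤ 1` and `u ≥ 0` then `γ_iΛ̃u ≤ u` (`= Ξ̃(u,fã)` for `fã ≤ 1`).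
[cite: KozmaNitzan2024, Question 8 (§5.5 p. 36)] -/
theorem kGen_xi_small (Λ γ u : ℝ) (hΛ : Λ ≤ 1) (hγ0 : 0 ≤ γ) (hγ1 : γ ≤ 1) (hu : 0 ≤ u) :
    γ * Λ * u ≤ u := by
  have : γ * Λ ≤ 1 := by nlinarith
  nlinarith

/-- **Prefix A-death is kill-visible.**  With `0 < a_l ≤ a₀ ≤ 1` and `fã_l = 1/a_l − 1/a₀`:  `a_l·fã_l = 1 − a_l/a₀ ≤ 1 − a_l`, so the per-depth
kill core `kLC_core_depth` (hypothesis `a_l·fa_l ≤ 1 − a_l`) applies with `fã_l` in place of `fa_l`.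
[cite: KozmaNitzan2024, Question 8 (§5.5 p. 36)] -/
theorem kGen_fat_le (al a₀ : ℝ) (hal : 0 < al) (hala : al ≤ a₀) (ha₀ : a₀ ≤ 1) :
    al * (1 / al - 1 / a₀) ≤ 1 - al := by
  have ha₀0 : 0 < a₀ := lt_of_lt_of_le hal hala
  rw [mul_sub, mul_one_div, div_self hal.ne', mul_one_div]
  have : al ≤ al / a₀ := by
    rw [le_div_iff₀ ha₀0]; nlinarith
  linarith

/-- **Unified joint member M1''.**  `JB·Ω ≤ γ_{v−1}Λ̃·B` (the exact joint member times its weight), `Ω ≥ C_{k₁,v−1}·M > 0` (PROPOSITION D3''),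
`γ_{v−1} = γ_i·C_{k₁,v−1}`, `B = P·u` (`P = POST₂x = BUD₀/u_{k₁}`), and the Ξ-lemma `γ_iΛ̃u ≤ X`:  then `JB ≤ X·P/M`.
[cite: KozmaNitzan2024, Question 8 (§5.5 p. 36)] -/
theorem kGen_member1 (JB Ω γv γi Ckv Λ B P u M X : ℝ) (hJB : JB * Ω ≤ γv * Λ * B) (hΩ : Ckv * M ≤ Ω) (hM : 0 < M) (hCkv : 0 < Ckv)
    (hγv : γv = γi * Ckv) (hB : B = P * u) (hP : 0 ≤ P) (hu : 0 ≤ u) (hΛ : 0 ≤ Λ) (hγi : 0 ≤ γi) (hX : γi * Λ * u ≤ X) :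
    JB ≤ X * P / M := by
  have hΩ0 : 0 < Ω := lt_of_lt_of_le (mul_pos hCkv hM) hΩ
  rw [le_div_iff₀ hM]
  -- JB·M ≤ JB·Ω/Ckv ≤ γi Λ P u ≤ X P
  have h1 : JB * (Ckv * M) ≤ γv * Λ * B := by
    by_cases h : 0 ≤ JB
    · exact le_trans (mul_le_mul_of_nonneg_left hΩ h) hJB
    · push Not at h
      have : JB * (Ckv * M) ≤ 0 := by nlinarith [mul_pos hCkv hM]
      have : 0 ≤ γv * Λ * B := by rw [hγv, hB]; positivity
      linarith
  have h2 : γv * Λ * B = Ckv * ((γi * Λ * u) * P) := by rw [hγv, hB]; ring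
  have h3 : (γi * Λ * u) * P ≤ X * P := mul_le_mul_of_nonneg_right hX hP
  have h4 : JB * (Ckv * M) ≤ Ckv * (X * P) := by
    calc JB * (Ckv * M) ≤ Ckv * ((γi * Λ * u) * P) := by rw [← h2]; exact h1
      _ ≤ Ckv * (X * P) := mul_le_mul_of_nonneg_left h3 hCkv.le
  nlinarith

/-- **Unified kill member M2''.**  `KQ·KW ≤ γ_{v−1}Λ̃·Q3`, `KW ≥ (1−ǔ)·C_{k₁+1,v−1}·Φ·BRG > 0` (general kill core), `γ_{v−1} = γ_{k₁}·C_{k₁+1,v−1}`,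
`γ_{k₁} ≤ γ_i`, `Q3 = q·u` and `γ_iΛ̃u ≤ X`:  then `KQ ≤ X·q/((1−ǔ)·Φ·BRG)`.
[cite: KozmaNitzan2024, Question 8 (§5.5 p. 36)] -/
theorem kGen_member2 (KQ KW γv γk γi Cv Λ Q3 q u uc Φ BRG X : ℝ) (hKQ : KQ * KW ≤ γv * Λ * Q3) (hKW : (1 - uc) * Cv * Φ * BRG ≤ KW)
    (huc : uc < 1) (hCv : 0 < Cv) (hΦ : 0 < Φ) (hBRG : 0 < BRG) (hγv : γv = γk * Cv) (hγk : γk ≤ γi) (hγk0 : 0 ≤ γk)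
    (hQ3 : Q3 = q * u) (hq : 0 ≤ q) (hu : 0 ≤ u) (hΛ : 0 ≤ Λ) (hX : γi * Λ * u ≤ X) :
    KQ ≤ X * q / ((1 - uc) * Φ * BRG) := by
  have hD : 0 < (1 - uc) * Φ * BRG := by
    have : 0 < 1 - uc := by linarith
    positivity
  have hW0 : 0 < (1 - uc) * Cv * Φ * BRG := by
    have : 0 < 1 - uc := by linarith
    positivity
  have hKW0 : 0 < KW := lt_of_lt_of_le hW0 hKW
  rw [le_div_iff₀ hD]
  have h1 : KQ * ((1 - uc) * Cv * Φ * BRG) ≤ γv * Λ * Q3 := by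
    by_cases h : 0 ≤ KQ
    · exact le_trans (mul_le_mul_of_nonneg_left hKW h) hKQ
    · push Not at h
      have : KQ * ((1 - uc) * Cv * Φ * BRG) ≤ 0 := by nlinarith
      have : 0 ≤ γv * Λ * Q3 := by rw [hγv, hQ3]; positivity
      linarith
  have h2 : γv * Λ * Q3 ≤ Cv * (X * q) := by
    rw [hγv, hQ3]
    have e : γk * Cv * Λ * (q * u) = Cv * ((γk * Λ * u) * q) := by ring
    rw [e]
    have h3 : γk * Λ * u ≤ γi * Λ * u := by
      have := mul_le_mul_of_nonneg_right hγk (mul_nonneg hΛ hu)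
      nlinarith
    have h4 : (γk * Λ * u) * q ≤ X * q := mul_le_mul_of_nonneg_right (le_trans h3 hX) hq
    exact mul_le_mul_of_nonneg_left h4 hCv.le
  have h5 : KQ * ((1 - uc) * Cv * Φ * BRG) = Cv * (KQ * ((1 - uc) * Φ * BRG)) := by ring
  have h6 : Cv * (KQ * ((1 - uc) * Φ * BRG)) ≤ Cv * (X * q) := by rw [← h5]; exact le_trans h1 h2
  exact le_of_mul_le_mul_left h6 hCv

/-- **Telescoping step behind `S·L' ≤ 1 − S`.**  With `S_{j+1} = s·S_j`, `0 ≤ s ≤ 1`, `0 ≤ S_j` and `S ≤ S_{j+1}` (the region's product is below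
every partial product):  `(1−s)·S ≤ S_j − S_{j+1}`.  Summing over the prefix depths `j < i`:  `S·Σ_{j<i}(1−s_{j+1}) ≤ 1 − S_i ≤ 1 − S`.
[cite: KozmaNitzan2024, Question 8 (§5.5 p. 36)] -/
theorem kGen_SLprime (s Sj S : ℝ) (hs1 : s ≤ 1) (hSj : 0 ≤ Sj) (hS : S ≤ s * Sj) :
    (1 - s) * S ≤ Sj - s * Sj := by
  have h1 : (1 - s) * S ≤ (1 - s) * (s * Sj) := mul_le_mul_of_nonneg_left hS (by linarith)
  nlinarith [mul_nonneg hSj (sq_nonneg (1 - s))]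

/-- **Prefix A-loss ratio.**  LEMMA (PA) at the last positive depth gives `(1−a)·K ≤ a²ΦS·u` with `K = K₃ − H_{i−1} ≥ ¾(Φ+m) > 0`; the prefix
A-death `d = 1 − A_[1,i] ≤ 1 − a` therefore satisfies `r := d/(uS) ≤ a²Φ/K ≤ (4/3)a²x` (`x = Φ/(Φ+m)`).
[cite: KozmaNitzan2024, Question 8 (§5.5 p. 36)] -/
theorem kGen_PA_ratio (d a K Φ m S u : ℝ) (hd : d ≤ 1 - a) (hPA : (1 - a) * K ≤ a ^ 2 * Φ * S * u) (hK : 3 / 4 * (Φ + m) ≤ K)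
    (hΦm : 0 < Φ + m) (hΦ : 0 ≤ Φ) (hS : 0 < S) (hu : 0 < u) :
    d / (u * S) ≤ 4 / 3 * a ^ 2 * (Φ / (Φ + m)) := by
  have hK0 : 0 < K := lt_of_lt_of_le (by linarith) hK
  rw [div_le_iff₀ (mul_pos hu hS)]
  -- d ≤ (1−a) ≤ a²ΦSu/K ≤ (4/3) a² Φ S u/(Φ+m)
  have h1 : d * K ≤ a ^ 2 * Φ * S * u := le_trans (mul_le_mul_of_nonneg_right hd hK0.le) hPA
  have h2 : d ≤ a ^ 2 * Φ * S * u / K := by rw [le_div_iff₀ hK0]; exact h1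
  have hnum : 0 ≤ a ^ 2 * Φ * S * u := by positivity
  have h34 : 0 < 3 / 4 * (Φ + m) := by linarith
  have h3 : a ^ 2 * Φ * S * u / K ≤ a ^ 2 * Φ * S * u / (3 / 4 * (Φ + m)) :=
    div_le_div_of_nonneg_left hnum h34 hK
  have h4 : a ^ 2 * Φ * S * u / (3 / 4 * (Φ + m)) = 4 / 3 * a ^ 2 * (Φ / (Φ + m)) * (u * S) := by
    field_simp
  linarith [h2, h3, h4.le, h4.ge]

/-- **The U‴ constant for the general prefix.**  With `Q₊ ≤ q·u`, `q = ¼a₀⁴xΦS(1−S)(1+r)` (LEMMA E♯ with the prefix A-loss ratio) and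
`m_t ≥ ¾(Φ+m) > 0`:  `ε'' := Q₊/(u·m_t) ≤ a₀⁴x²S(1−S)(1+r)/3`.
[cite: KozmaNitzan2024, Question 8 (§5.5 p. 36)] -/
theorem kGen_eps (Q q u mt a₀ x Φ m S r : ℝ) (hQ : Q ≤ q * u) (hq : q = 1 / 4 * a₀ ^ 4 * x * Φ * S * (1 - S) * (1 + r))
    (hx : x = Φ / (Φ + m)) (hmt : 3 / 4 * (Φ + m) ≤ mt) (hΦm : 0 < Φ + m) (hu : 0 < u) (hS0 : 0 ≤ S) (hS1 : S ≤ 1) (hr : 0 ≤ 1 + r)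
    (hΦ : 0 ≤ Φ) :
    Q / (u * mt) ≤ a₀ ^ 4 * x ^ 2 * S * (1 - S) * (1 + r) / 3 := by
  have hmt0 : 0 < mt := lt_of_lt_of_le (by linarith) hmt
  rw [div_le_iff₀ (mul_pos hu hmt0)]
  have hq0 : 0 ≤ q := by
    rw [hq, hx]
    have : 0 ≤ Φ / (Φ + m) := div_nonneg hΦ hΦm.le
    have : 0 ≤ 1 - S := by linarith
    positivity
  have h1 : Q ≤ q * u := hQ
  -- q u ≤ [a₀⁴x²S(1−S)(1+r)/3] u mt  since  ¼ x Φ ≤ (x²/3)·mt  ⟸ mt ≥ ¾(Φ+m), x(Φ+m) = Φ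
  have hxΦ : x * (Φ + m) = Φ := by rw [hx]; field_simp
  have hx0 : 0 ≤ x := by rw [hx]; exact div_nonneg hΦ hΦm.le
  have h2 : 1 / 4 * x * Φ ≤ x ^ 2 / 3 * mt := by
    have : x ^ 2 / 3 * (3 / 4 * (Φ + m)) ≤ x ^ 2 / 3 * mt := mul_le_mul_of_nonneg_left hmt (by positivity)
    have e : x ^ 2 / 3 * (3 / 4 * (Φ + m)) = 1 / 4 * x * (x * (Φ + m)) := by ring
    rw [e, hxΦ] at this; exact this
  have h3 : q * u ≤ a₀ ^ 4 * x ^ 2 * S * (1 - S) * (1 + r) / 3 * (u * mt) := by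
    rw [hq]
    have hc : 0 ≤ a₀ ^ 4 * S * (1 - S) * (1 + r) * u := by
      have : 0 ≤ 1 - S := by linarith
      positivity
    have := mul_le_mul_of_nonneg_left h2 hc
    nlinarith
  linarith

/-- **`g(x,θ)/θ` is non-decreasing in `θ`** (box monotonicity: `g(x,θ) = xθ²/(1+h(θ))²`, `h(θ) = √(1−θ(1−x))` non-increasing in `θ`):
for `0 ≤ θ₁ ≤ θ₂`, `0 ≤ h₂ ≤ h₁` and `x ≥ 0`:  `xθ₁/(1+h₁)² ≤ xθ₂/(1+h₂)²`.  Used as `g(x,θ_j)(1−d_j) ≤ (1−d)g(x,a₀/γ_i)`.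
[cite: KozmaNitzan2024, Question 8 (§5.5 p. 36)] -/
theorem kGen_gmono (x θ₁ θ₂ h₁ h₂ : ℝ) (hx : 0 ≤ x) (hθ0 : 0 ≤ θ₁) (hθ : θ₁ ≤ θ₂) (hh0 : 0 ≤ h₂) (hh : h₂ ≤ h₁) :
    x * θ₁ / (1 + h₁) ^ 2 ≤ x * θ₂ / (1 + h₂) ^ 2 := by
  have hh1 : 0 ≤ h₁ := le_trans hh0 hh
  have hD1 : 0 < (1 + h₁) ^ 2 := by positivity
  have hD2 : 0 < (1 + h₂) ^ 2 := by positivity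
  calc x * θ₁ / (1 + h₁) ^ 2 ≤ x * θ₁ / (1 + h₂) ^ 2 := by
        apply div_le_div_of_nonneg_left (mul_nonneg hx hθ0) hD2
        nlinarith
    _ ≤ x * θ₂ / (1 + h₂) ^ 2 := by
        apply div_le_div_of_nonneg_right _ hD2.le
        exact mul_le_mul_of_nonneg_left hθ hx

/-- **Box monotonicity: `D'/M` is non-increasing in `ǔ`.**  `D' = α + (1−α)ǔ`, `M = αS̄(1−ǔ) + ǔ`; for `ǔ₁ ≤ ǔ₂`:
`D'(ǔ₂)·M(ǔ₁) ≤ D'(ǔ₁)·M(ǔ₂)` (the difference is `(ǔ₁−ǔ₂)·α·(1−S̄) ≤ 0`).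
[cite: KozmaNitzan2024, Question 8 (§5.5 p. 36)] -/
theorem kGen_DM_uc (α Sb u₁ u₂ : ℝ) (hα : 0 ≤ α) (hSb : Sb ≤ 1) (hu : u₁ ≤ u₂) :
    (α + (1 - α) * u₂) * (α * Sb * (1 - u₁) + u₁) ≤ (α + (1 - α) * u₁) * (α * Sb * (1 - u₂) + u₂) := by
  have e : (α + (1 - α) * u₁) * (α * Sb * (1 - u₂) + u₂) - (α + (1 - α) * u₂) * (α * Sb * (1 - u₁) + u₁)
      = (u₂ - u₁) * α * (1 - Sb) := by ring
  nlinarith [mul_nonneg (mul_nonneg (sub_nonneg.mpr hu) hα) (sub_nonneg.mpr hSb)]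

/-- **Box monotonicity: `D'/M` is non-decreasing in `α`.**  For `α₁ ≤ α₂`, `0 ≤ ǔ ≤ 1`, `S̄ ≤ 1`:
`D'(α₁)·M(α₂) ≤ D'(α₂)·M(α₁)` (the difference is `(α₂−α₁)·ǔ(1−ǔ)(1−S̄) ≥ 0`).
[cite: KozmaNitzan2024, Question 8 (§5.5 p. 36)] -/
theorem kGen_DM_alpha (α₁ α₂ Sb u : ℝ) (hα : α₁ ≤ α₂) (hu0 : 0 ≤ u) (hu1 : u ≤ 1) (hSb : Sb ≤ 1) :
    (α₁ + (1 - α₁) * u) * (α₂ * Sb * (1 - u) + u) ≤ (α₂ + (1 - α₂) * u) * (α₁ * Sb * (1 - u) + u) := by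
  have e : (α₂ + (1 - α₂) * u) * (α₁ * Sb * (1 - u) + u) - (α₁ + (1 - α₁) * u) * (α₂ * Sb * (1 - u) + u)
      = (α₂ - α₁) * u * (1 - u) * (1 - Sb) := by ring
  nlinarith [mul_nonneg (mul_nonneg (mul_nonneg (sub_nonneg.mpr hα) hu0) (sub_nonneg.mpr hu1)) (sub_nonneg.mpr hSb)]

end PocketCert

end Summit.CriticalPhenomena.PercolationContinuityZ3.Theorems
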